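import Mathlib
import Literature.AlgebraicGeometry.HyperbolicPolynomials.HyperbolicityCone
import Literature.AlgebraicGeometry.HyperbolicPolynomials.SpectrahedralShadow
import Literature.AlgebraicGeometry.HyperbolicPolynomials.SpectrahedralShadowProofs
import Summits.ValiantsHypothesis.ValiantsHypothesis.Theorems.PermanentalConesPermanentalHyperbolic

/-!
# `PermanentalConeHard` (stmt-ValiantsHypothesis-8654), line `birth` — the all-ones member is no witness

Route `PermanentalCones` of `ValiantsHypothesis`, crux `PermanentalConeHard` (H+): a nonnegative
permanental family `Q_n = per[(Y_n)_{rows<r n}; x^{(n-r n)}]` whose closed hyperbolicity cones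
`{x : ∀ τ > 0, Q_n(x + τ𝟙) ≠ 0}` admit NO lifted-LMI description `{x : ∃ y, A(x,y) + B ⪰ 0}` of size
`m ≤ 2^((log₂ n + c)^c)`, for every level `c` at some `n`.

This file records the canonical TIGHTNESS fact (`stub_allOnesNotWitness`): the all-ones member
`Y ≡ J` (with any number `r` of constant rows) is never a witness.  Indeed

* IDENTITY (`AllOnes.rowPermanent_eq_C_mul_esymm`): `per[J_{rows<r}; x^{(n-r)}] = c · e_{n-r}(x)`
  with `c > 0` (`c = r! (n-r)!`; for `r ≥ n` all rows are constant and the permanent is `n! = n! e₀`),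
  proved by induction on `r` from `per[x^{(n)}] = n! x₁⋯xₙ = n! eₙ` via Gurvits' row recursion
  `sum_C_mul_pderiv_rowPermanent` (`(n-k) per[J_{<k+1}; x] = ∑ⱼ ∂ⱼ per[J_{<k}; x]`) and the Euler-type
  identity `∑ⱼ ∂ⱼ e_{d+1} = (n - d) e_d` (`AllOnes.sum_pderiv_esymm_succ`);
* CONE: hence the closed cone of the member is `Λ₊(e_{n-r}, 𝟙)`, Renegar's derivative relaxation
  of the orthant;
* LIFT: by the (fully proved) Saunderson–Parrilo derivative-based recursion
  `hasExpPsdLift_cone_deriv` + `isSpectrahedralShadowOfSize_of_hasExpPsdLift`, `Λ₊(e_d, 𝟙) ⊆ ℝ^{d+j}`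
  has a lifted-LMI description of size `d + j (2 + n (2n+1)) ≤ 8 (n+1)^3`;
* SIZE: `8 (n+1)^3 ≤ 2^(3 log₂ n + 6) ≤ 2^((log₂ n + 4)^4)`, so the member meets the size clause
  already at level `c = 4`, for every `n` and every `r`.

References: J. Saunderson, P. A. Parrilo, *Polynomial-sized semidefinite representations of
derivative relaxations of spectrahedral cones*, Math. Program. 153 (2015) 309–331, Thm. 1 and §2.2
(tree file `Literature/AlgebraicGeometry/HyperbolicPolynomials/SpectrahedralShadowProofs`);
L. Gurvits, *Van der Waerden/Schrijver–Valiant like conjectures and stable homogeneous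
polynomials*, Electron. J. Combin. 15 (2008) (row recursion, tree file
`PermanentalConesPermanentalHyperbolic`).  Everything here is proved in full.
-/

set_option linter.dupNamespace false

noncomputable section

namespace Summit.ValiantsHypothesis.ValiantsHypothesis.Theorems.PermanentalConesPermanentalConeHard

open MvPolynomial Finset
open scoped BigOperators
open Literature.AlgebraicGeometry.HyperbolicPolynomials

namespace AllOnes

/-- A squarefree monomial `x^T` has zero `j`-th partial derivative when `j ∉ T`. [folklore] -/
theorem pderiv_prod_X_of_notMem {σ R : Type*} [CommSemiring R] (T : Finset σ) {j : σ}
    (hj : j ∉ T) : pderiv j (∏ i ∈ T, (X i : MvPolynomial σ R)) = 0 := by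
  refine Finset.prod_induction _ (fun f => pderiv j f = 0) (fun f g hf hg => ?_) pderiv_one
    (fun i hi => pderiv_X_of_ne (ne_of_mem_of_not_mem hi hj))
  rw [pderiv_mul, hf, hg, zero_mul, mul_zero, add_zero]

/-- `∂ⱼ x^T = x^{T ∖ {j}}` for a squarefree monomial `x^T` with `j ∈ T`. [folklore] -/
theorem pderiv_prod_X_of_mem {σ R : Type*} [CommSemiring R] [DecidableEq σ] (T : Finset σ)
    {j : σ} (hj : j ∈ T) :
    pderiv j (∏ i ∈ T, (X i : MvPolynomial σ R)) = ∏ i ∈ T.erase j, X i := by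
  rw [← Finset.mul_prod_erase T (fun i => (X i : MvPolynomial σ R)) hj, pderiv_mul, pderiv_X_self,
    one_mul, pderiv_prod_X_of_notMem (T.erase j) (Finset.notMem_erase j T), mul_zero, add_zero]

/-- **Euler-type identity for the elementary symmetric polynomials**:
`∑ⱼ ∂ⱼ e_{d+1} = (n - d) · e_d` in `n = |σ|` variables (each `d`-set `T'` arises as `T ∖ {j}` from
exactly the `n - d` pairs `(T' ∪ {j}, j)` with `j ∉ T'`). [folklore] -/
theorem sum_pderiv_esymm_succ (σ R : Type*) [Fintype σ] [CommSemiring R] (d : ℕ) :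
    ∑ j, pderiv j (MvPolynomial.esymm σ R (d + 1)) =
      (Fintype.card σ - d) • MvPolynomial.esymm σ R d := by
  classical
  -- `∂ⱼ e_{d+1} = ∑_{|T| = d, j ∉ T} x^T`
  have hj : ∀ j : σ, pderiv j (MvPolynomial.esymm σ R (d + 1)) =
      ∑ T ∈ (powersetCard d (univ : Finset σ)).filter (fun T => j ∉ T),
        ∏ i ∈ T, (X i : MvPolynomial σ R) := by
    intro j
    rw [MvPolynomial.esymm, map_sum, ← Finset.sum_filter_add_sum_filter_not _ (fun T => j ∈ T)]
    have h0 : ∑ T ∈ (powersetCard (d + 1) (univ : Finset σ)).filter (fun T => ¬ j ∈ T),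
        pderiv j (∏ i ∈ T, (X i : MvPolynomial σ R)) = 0 :=
      Finset.sum_eq_zero fun T hT => pderiv_prod_X_of_notMem T (Finset.mem_filter.1 hT).2
    rw [h0, add_zero,
      Finset.sum_congr rfl fun T hT => pderiv_prod_X_of_mem T (Finset.mem_filter.1 hT).2]
    refine Finset.sum_nbij' (fun T => T.erase j) (fun T => insert j T) ?_ ?_ ?_ ?_ fun _ _ => rfl
    · intro T hT
      simp only [Finset.mem_filter, Finset.mem_powersetCard, Finset.subset_univ, true_and] at hT ⊢
      exact ⟨by rw [Finset.card_erase_of_mem hT.2, hT.1, Nat.add_sub_cancel],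
        Finset.notMem_erase j T⟩
    · intro T hT
      simp only [Finset.mem_filter, Finset.mem_powersetCard, Finset.subset_univ, true_and] at hT ⊢
      exact ⟨by rw [Finset.card_insert_of_notMem hT.2, hT.1], Finset.mem_insert_self j T⟩
    · intro T hT
      exact Finset.insert_erase (Finset.mem_filter.1 hT).2
    · intro T hT
      exact Finset.erase_insert (Finset.mem_filter.1 hT).2
  calc ∑ j, pderiv j (MvPolynomial.esymm σ R (d + 1))
      = ∑ j, ∑ T ∈ (powersetCard d (univ : Finset σ)).filter (fun T => j ∉ T),
          ∏ i ∈ T, (X i : MvPolynomial σ R) := Finset.sum_congr rfl fun j _ => hj j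
    _ = ∑ T ∈ powersetCard d (univ : Finset σ), ∑ _j ∈ univ.filter (fun j : σ => j ∉ T),
          ∏ i ∈ T, (X i : MvPolynomial σ R) := by
        refine Finset.sum_comm' fun j T => ?_
        simp only [Finset.mem_filter, Finset.mem_univ, true_and]
        exact And.comm
    _ = (Fintype.card σ - d) • MvPolynomial.esymm σ R d := by
        rw [MvPolynomial.esymm, Finset.smul_sum]
        refine Finset.sum_congr rfl fun T hT => ?_
        have hc : (univ.filter fun j : σ => j ∉ T) = Tᶜ := by
          ext j
          simp
        rw [Finset.sum_const, hc, Finset.card_compl, (Finset.mem_powersetCard.1 hT).2]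

/-- `e_n(x₁, …, xₙ) = x₁ ⋯ xₙ`. [folklore] -/
theorem esymm_fin_self (n : ℕ) :
    MvPolynomial.esymm (Fin n) ℝ n = ∏ i : Fin n, (X i : MvPolynomial (Fin n) ℝ) := by
  have h := Finset.powersetCard_self (Finset.univ : Finset (Fin n))
  rw [Finset.card_univ, Fintype.card_fin] at h
  rw [MvPolynomial.esymm, h, Finset.sum_singleton]

/-- **Base of the induction** (no constant rows): `per[x^{(n)}] = n! · x₁ ⋯ xₙ = n! · eₙ`.
[folklore] -/
theorem rowPermanent_zero (n : ℕ) :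
    (Matrix.of fun i j : Fin n =>
        if (i : ℕ) < 0 then C (1 : ℝ) else (X j : MvPolynomial (Fin n) ℝ)).permanent =
      C ((Nat.factorial n : ℕ) : ℝ) * MvPolynomial.esymm (Fin n) ℝ n := by
  have hmat : (Matrix.of fun i j : Fin n =>
      if (i : ℕ) < 0 then C (1 : ℝ) else (X j : MvPolynomial (Fin n) ℝ)) =
      Matrix.of fun _ j : Fin n => (X j : MvPolynomial (Fin n) ℝ) := by
    ext i j
    rw [Matrix.of_apply, Matrix.of_apply, if_neg (Nat.not_lt_zero _)]
  rw [hmat, esymm_fin_self]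
  unfold Matrix.permanent
  simp only [Matrix.of_apply]
  rw [Finset.sum_const, Finset.card_univ, Fintype.card_perm, Fintype.card_fin, nsmul_eq_mul,
    map_natCast]

/-- **IDENTITY.** The all-ones member with `k` constant rows is a positive multiple of the
elementary symmetric polynomial of degree `n - k`:
`per[J_{rows<k}; x^{(n-k)}] = c · e_{n-k}(x)`, `c > 0` (namely `c = (min k n)! (n-k)!`; for
`k ≥ n` the permanent is the constant `n! = n! e₀`).  Induction on `k` via Gurvits' row recursion
`sum_C_mul_pderiv_rowPermanent` with `Y ≡ 1` and `sum_pderiv_esymm_succ`. [folklore] -/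
theorem rowPermanent_eq_C_mul_esymm (n k : ℕ) : ∃ c : ℝ, 0 < c ∧
    (Matrix.of fun i j : Fin n =>
        if (i : ℕ) < k then C (1 : ℝ) else (X j : MvPolynomial (Fin n) ℝ)).permanent =
      C c * MvPolynomial.esymm (Fin n) ℝ (n - k) := by
  induction k with
  | zero =>
    exact ⟨(Nat.factorial n : ℕ), by exact_mod_cast Nat.factorial_pos n,
      by rw [rowPermanent_zero, Nat.sub_zero]⟩
  | succ k ih =>
    obtain ⟨c, hc, hk⟩ := ih
    rcases lt_or_ge k n with hkn | hnk
    · -- Gurvits' row recursion with `Y ≡ 1`: `∑ⱼ ∂ⱼ P_k = #{a : k ≤ a} • P_{k+1}`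
      have hrec : (∑ j : Fin n, C (1 : ℝ) * pderiv j (Matrix.of fun a b : Fin n =>
          if (a : ℕ) < k then C (1 : ℝ) else (X b : MvPolynomial (Fin n) ℝ)).permanent) =
          ∑ _a ∈ univ.filter (fun a : Fin n => k ≤ (a : ℕ)), (Matrix.of fun a b : Fin n =>
            if (a : ℕ) < k + 1 then C (1 : ℝ) else (X b : MvPolynomial (Fin n) ℝ)).permanent :=
        sum_C_mul_pderiv_rowPermanent (fun _ _ => (1 : ℝ)) hkn
      set P₁ := (Matrix.of fun a b : Fin n =>
        if (a : ℕ) < k + 1 then C (1 : ℝ) else (X b : MvPolynomial (Fin n) ℝ)).permanent with hP₁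
      obtain ⟨d, hd⟩ : ∃ d, n - k = d + 1 := ⟨n - k - 1, by omega⟩
      -- `N • P_{k+1} = c (n - d) • e_d`
      have key : (univ.filter (fun a : Fin n => k ≤ (a : ℕ))).card • P₁ =
          C c * ((n - d) • MvPolynomial.esymm (Fin n) ℝ d) := by
        rw [← Finset.sum_const, ← hrec, hk, hd]
        have h1 : ∀ j : Fin n, C (1 : ℝ) * pderiv j (C c * MvPolynomial.esymm (Fin n) ℝ (d + 1)) =
            C c * pderiv j (MvPolynomial.esymm (Fin n) ℝ (d + 1)) := fun j => by
          rw [C_1, one_mul, pderiv_C_mul]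
        simp only [h1]
        rw [← Finset.mul_sum, sum_pderiv_esymm_succ, Fintype.card_fin]
      obtain ⟨N, hN⟩ : ∃ N, (univ.filter (fun a : Fin n => k ≤ (a : ℕ))).card = N := ⟨_, rfl⟩
      have hNpos : 0 < N := by
        rw [← hN]
        exact Finset.card_pos.2 ⟨⟨k, hkn⟩, Finset.mem_filter.2 ⟨Finset.mem_univ _, le_refl k⟩⟩
      rw [hN] at key
      have hN' : (0 : ℝ) < (N : ℝ) := by exact_mod_cast hNpos
      have hm : (0 : ℝ) < ((n - d : ℕ) : ℝ) := by exact_mod_cast (show 0 < n - d by omega)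
      refine ⟨c * ((n - d : ℕ) : ℝ) / (N : ℝ), div_pos (mul_pos hc hm) hN', ?_⟩
      have key' : (N : ℝ) • P₁ = (c * ((n - d : ℕ) : ℝ)) • MvPolynomial.esymm (Fin n) ℝ d := by
        rw [Nat.cast_smul_eq_nsmul, key, ← Nat.cast_smul_eq_nsmul ℝ (n - d), smul_eq_C_mul,
          smul_eq_C_mul, map_mul, mul_assoc]
      rw [show n - (k + 1) = d by omega]
      calc P₁ = (N : ℝ)⁻¹ • ((N : ℝ) • P₁) := (inv_smul_smul₀ hN'.ne' _).symm
        _ = C (c * ((n - d : ℕ) : ℝ) / (N : ℝ)) * MvPolynomial.esymm (Fin n) ℝ d := by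
          rw [key', smul_smul, smul_eq_C_mul, div_eq_inv_mul]
    · -- `n ≤ k`: one more constant row changes nothing, and `n - (k+1) = n - k = 0`
      refine ⟨c, hc, ?_⟩
      have hmat : (Matrix.of fun i j : Fin n =>
          if (i : ℕ) < k + 1 then C (1 : ℝ) else (X j : MvPolynomial (Fin n) ℝ)) =
          Matrix.of fun i j : Fin n =>
            if (i : ℕ) < k then C (1 : ℝ) else (X j : MvPolynomial (Fin n) ℝ) :=
        rowMatrix_succ_of_le (fun _ _ => (1 : ℝ)) hnk
      rw [hmat, hk, show n - (k + 1) = n - k by omega]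

/-- **LIFT** (Saunderson–Parrilo, derivative-based recursion, fully proved in the tree):
`Λ₊(e_d, 𝟙) ⊆ ℝ^N`, `N = d + j`, has a lifted-LMI description of size `d + j (2 + N (2N+1))`.
[cite: SaundersonParrilo2014, Theorem 1; §2.2] -/
theorem isSpectrahedralShadowOfSize_cone_esymm (N d j : ℕ) (h : N = d + j) :
    IsSpectrahedralShadowOfSize
      (hyperbolicityCone (MvPolynomial.esymm (Fin N) ℝ d) (fun _ => (1 : ℝ)))
      (d + j * (2 + N * (2 * N + 1))) := by
  subst h
  exact isSpectrahedralShadowOfSize_of_hasExpPsdLift (hasExpPsdLift_cone_deriv d j)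

/-- **SIZE.** The Saunderson–Parrilo size with `d = n - r`, `j = min r n` is at most
`8 (n+1)^3 ≤ 2^(3 log₂ n + 6) ≤ 2^((log₂ n + 4)^4)`: level `c = 4` suffices for every `n`.
[folklore] -/
theorem size_le (n r : ℕ) :
    n - r + min r n * (2 + n * (2 * n + 1)) ≤ 2 ^ ((Nat.log 2 n + 4) ^ 4) := by
  have hn : n < 2 ^ (Nat.log 2 n + 1) := Nat.lt_pow_succ_log_self Nat.one_lt_two n
  have h1 : n - r + min r n * (2 + n * (2 * n + 1)) ≤ n + n * (2 + n * (2 * n + 1)) :=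
    add_le_add (Nat.sub_le n r) (Nat.mul_le_mul_right _ (min_le_right r n))
  have h2 : n + n * (2 + n * (2 * n + 1)) ≤ 8 * (n + 1) ^ 3 := by
    nlinarith [Nat.zero_le (n ^ 3), Nat.zero_le (n ^ 2)]
  have h3 : (n + 1) ^ 3 ≤ (2 ^ (Nat.log 2 n + 1)) ^ 3 := Nat.pow_le_pow_left hn 3
  have h4 : 8 * (2 ^ (Nat.log 2 n + 1)) ^ 3 = 2 ^ (3 * Nat.log 2 n + 6) := by
    ring
  have h64 : 64 ≤ (Nat.log 2 n + 4) ^ 3 :=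
    calc (64 : ℕ) = 4 ^ 3 := by norm_num
      _ ≤ (Nat.log 2 n + 4) ^ 3 := Nat.pow_le_pow_left (by omega) 3
  have h5 : 3 * Nat.log 2 n + 6 ≤ (Nat.log 2 n + 4) ^ 4 :=
    calc 3 * Nat.log 2 n + 6 ≤ (Nat.log 2 n + 4) * 64 := by omega
      _ ≤ (Nat.log 2 n + 4) * (Nat.log 2 n + 4) ^ 3 := Nat.mul_le_mul_left _ h64
      _ = (Nat.log 2 n + 4) ^ 4 := by ring
  calc n - r + min r n * (2 + n * (2 * n + 1)) ≤ 8 * (n + 1) ^ 3 := h1.trans h2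
    _ ≤ 8 * (2 ^ (Nat.log 2 n + 1)) ^ 3 := Nat.mul_le_mul_left 8 h3
    _ = 2 ^ (3 * Nat.log 2 n + 6) := h4
    _ ≤ 2 ^ ((Nat.log 2 n + 4) ^ 4) := Nat.pow_le_pow_right (by norm_num) h5

end AllOnes

/-- Registered form (`stub_allOnesNotWitness`): the all-ones member `Y ≡ J` of the permanental
family, `P = per[J_{rows<r}; x^{(n-r)}] = c · e_{n-r}(x)` (`c > 0`), has as closed hyperbolicity
cone (w.r.t. `𝟙`) the derivative relaxation `Λ₊(e_{n-r}, 𝟙)` of the orthant, which IS a lifted-LMI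
set of size `m = (n-r) + min r n · (2 + n(2n+1)) ≤ 2 ^ ((log₂ n + 4) ^ 4)` by the Saunderson–Parrilo
derivative-based recursion — so it meets the size clause at level `c = 4` for every `n` and `r`,
and is never a witness. [cite: SaundersonParrilo2014, Theorem 1; §2.2] -/
theorem stub_allOnesNotWitness : ∀ (n r : ℕ) (P : MvPolynomial (Fin n) ℝ), P = (Matrix.of fun i j : Fin n => if (i : ℕ) < r then MvPolynomial.C (1 : ℝ) else MvPolynomial.X j).permanent → ∃ m ≤ 2 ^ ((Nat.log 2 n + 4) ^ 4), ∃ (p : ℕ) (A : (Fin n → ℝ) × (Fin p → ℝ) →ₗ[ℝ] Matrix (Fin m) (Fin m) ℝ) (B : Matrix (Fin m) (Fin m) ℝ), ∀ x : Fin n → ℝ, (∀ τ : ℝ, 0 < τ → MvPolynomial.eval (fun j => x j + τ) P ≠ 0) ↔ ∃ y : Fin p → ℝ, (A (x, y) + B).PosSemidef := by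
  intro n r P hP
  -- IDENTITY: `P = c · e_{n-r}`, `c > 0`
  obtain ⟨c, hc, hPc⟩ := AllOnes.rowPermanent_eq_C_mul_esymm n r
  rw [← hP] at hPc
  -- LIFT: `Λ₊(e_{n-r}, 𝟙)` is a spectrahedral shadow of size `(n-r) + min r n · (2 + n(2n+1))`
  obtain ⟨p, A, B, hAB⟩ :=
    AllOnes.isSpectrahedralShadowOfSize_cone_esymm n (n - r) (min r n) (by omega)
  refine ⟨n - r + min r n * (2 + n * (2 * n + 1)), AllOnes.size_le n r, p, A, B, fun x => ?_⟩
  -- CONE: the inline clause is membership in `Λ₊(P, 𝟙) = Λ₊(c e_{n-r}, 𝟙) = Λ₊(e_{n-r}, 𝟙)`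
  rw [← hAB x, ← hyperbolicityCone_C_mul _ _ hc.ne', ← hPc, mem_hyperbolicityCone_iff]
  have hx : ∀ τ : ℝ, (x + τ • fun _ => (1 : ℝ)) = fun j => x j + τ := fun τ => by
    funext j
    simp
  simp only [hx]

end Summit.ValiantsHypothesis.ValiantsHypothesis.Theorems.PermanentalConesPermanentalConeHard

end
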